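import Literature.AlgebraicGeometry.ShimuraVarieties.UnitaryConeTwoPointBound
import Literature.AlgebraicGeometry.ShimuraVarieties.UnitaryBallDiscontinuity
import Literature.AlgebraicGeometry.ShimuraVarieties.UnitaryBallUniformisationLocalSection
import HarnessLib

/-!
# Torsion-free congruence subgroups of `U(p,1)`: the uniformisation of a compact ball quotient is locally injective modulo `ℂˣ`
# on the negative cone (every rank `p`, cone coordinates)

Topic `AlgebraicGeometry/ShimuraVarieties`, namespace `Literature.AlgebraicGeometry.ShimuraVarieties`, dotted on
`D : UnitaryBallUniformisationDatum p X` (★ `UnitaryBallQuotientDatum.lean`: CM field `E ⊆ ℂ`, anisotropic hermitian `H` on `E^{p+1}` of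
signature `(p,1)` at `τ₁` and definite at the other places, a torsion-free congruence subgroup `Γ ≤ U(H)(E)`, and the uniformisation
`unif : ℂ^{p+1} ⊇ negCone(H^{τ₁}) → X(ℂ)` whose fibres are the `Γ·ℂˣ`-orbits).  THEOREMS ONLY (no definition, no named fact, no instance,
no `sorry`).  Part 2 of 2 (part 1 = ★ `UnitaryConeTwoPointBound`: the invariant majorant and the two-point bound).

MAIN RESULT `UnitaryBallUniformisationDatum.exists_isOpen_unif_eq_unif_imp_smul`: **every negative vector `v₀` has an open neighbourhood
`U` such that two cone vectors `v, w ∈ U` with `unif v = unif w` are proportional** — the hypothesis `hinj` of ★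
`UnitaryBallUniformisationLocalSection.exists_mdifferentiableAt_section`, which is therefore discharged
(`exists_mdifferentiableAt_section'`: the uniformisation of `X^an` by the cone has holomorphic local sections through every cone vector,
in every rank).  The road is the classical one ([Borel1969] §1, Prop. 7.13: an arithmetic subgroup is discrete; a discrete torsion-free
subgroup acts freely and properly discontinuously on `G/K`), made elementary:

* §4 DISCRETENESS: only finitely many `γ ∈ Γ` have `‖τ₁(γᵢⱼ)‖ ≤ R` for all `i, j` (entries bounded at every complex embedding — the
  conjugate place carries the same norms, the other places are definite, ★ `exists_norm_embedding_apply_le` — and integral on the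
  finite-index principal congruence subgroup, ★ `isIntegral_apply`; Mathlib `NumberField.Embeddings.finite_of_norm_le`) — the `p = 2`
  argument of ★ `UnitaryBallDiscontinuity.finite_setOf_norm_entry_le` with `ballRep` replaced by the `τ₁`-entries;
* §5 FREENESS: `γ^{τ₁} v₀ ∈ ℂ v₀` forces `γ = 1` (the powers of `γ` lie in a finite set by the two-point bound at `K = {v₀}`, so `γ` is
  torsion; `Γ` is torsion free);
* §6 SEPARATION and ASSEMBLY: for the finitely many `γ ≠ 1` below the two-point bound of a compact cone neighbourhood `K` of `v₀`, the
  vectors `γ^{τ₁} v` and `w` stay linearly independent near `(v₀, v₀)` (a non-vanishing `2 × 2` minor); on the resulting `U`,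
  `unif v = unif w` means `γ^{τ₁} v = c w` with `γ` in that finite set, hence `γ = 1` and `v = c w`.

## References
* [Borel1969] A. Borel, *Introduction aux groupes arithmétiques*, Hermann 1969, §1 and Prop. 7.13.
* [BergeronMillsonMoeglin2016Balls] N. Bergeron, J. Millson, C. Moeglin, Acta Math. 216 (2016), Introduction §1.1 (`S(Γ) = Γ∖𝔹` is a
  compact complex manifold for torsion-free congruence `Γ`), Part 2 §1.3.
* [PlatonovRapinchuk1994] V. Platonov, A. Rapinchuk, *Algebraic Groups and Number Theory*, §3.2 Thm 3.1 (compactness at definite places).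
* [FritzscheGrauert2002] K. Fritzsche, H. Grauert, *From Holomorphic Functions to Complex Manifolds*, Ch. I §8 (the local-section corollary).
* Tree: ★ `UnitaryBallDiscontinuity` (`p = 2` and the rank-generic §Embeddings lemmas reused here), ★ `UnitaryConeTwoPointBound`, ★
  `UnitaryBallUniformisationLocalSection` (the consumer).
-/

set_option autoImplicit false

noncomputable section

open Matrix Complex NumberField Topology Set
open scoped ComplexOrder ComplexConjugate Manifold

namespace Literature.AlgebraicGeometry.ShimuraVarieties

namespace UnitaryBallUniformisationDatum

open Literature.AlgebraicGeometry.Motives (SchemeOver)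
open Literature.AlgebraicGeometry.HodgeTheory (HodgeModel)

variable {p : ℕ} {X : SchemeOver ℂ} (D : UnitaryBallUniformisationDatum p X)


/-- Entry bound for a product of square matrices: `‖(M N)ᵢⱼ‖ ≤ #m · R · S` (private copy of the part-1 plumbing lemma). [folklore] -/
private theorem norm_mul_apply_le_card' {m : Type*} [Fintype m] {M N : Matrix m m ℂ} {R S : ℝ} (hM : ∀ i j, ‖M i j‖ ≤ R)
    (hN : ∀ i j, ‖N i j‖ ≤ S) (i j : m) : ‖(M * N) i j‖ ≤ Fintype.card m * (R * S) := by
  rw [Matrix.mul_apply]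
  calc ‖∑ k, M i k * N k j‖ ≤ ∑ k, ‖M i k * N k j‖ := norm_sum_le _ _
    _ ≤ ∑ _k : m, R * S := Finset.sum_le_sum fun k _ ↦ by
        rw [norm_mul]
        exact mul_le_mul (hM i k) (hN k j) (norm_nonneg _) ((norm_nonneg _).trans (hM i k))
    _ = Fintype.card m * (R * S) := by simp

/-! ### §4 Discreteness: finitely many `γ ∈ Γ` with `τ₁`-entries of norm `≤ R` -/

/-- **Bounded at all embeddings**: if the `τ₁`-entries of `γ ∈ Γ` have norm `≤ R`, then `‖τ(γᵢⱼ)‖ ≤ B(R)` for EVERY complex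
embedding `τ` of `E` (the conjugate place carries the same norms, the other places are definite).
[cite: PlatonovRapinchuk1994, §3.2 Thm 3.1] -/
theorem exists_forall_norm_embedding_apply_le_of_τ₁ (R : ℝ) :
    ∃ B : ℝ, ∀ γ : D.Γ, (∀ i j, ‖D.τ₁ (((γ : GL (Fin (p + 1)) D.E) : Matrix (Fin (p + 1)) (Fin (p + 1)) D.E) i j)‖ ≤ R) →
      ∀ (τ : D.E →+* ℂ) (i j : Fin (p + 1)),
        ‖τ (((γ : GL (Fin (p + 1)) D.E) : Matrix (Fin (p + 1)) (Fin (p + 1)) D.E) i j)‖ ≤ B := by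
  have hC : ∀ τ : D.E →+* ℂ, ∃ C : ℝ, InfinitePlace.mk τ ≠ InfinitePlace.mk D.τ₁ →
      ∀ γ : D.Γ, ∀ i j, ‖τ (((γ : GL (Fin (p + 1)) D.E) : Matrix (Fin (p + 1)) (Fin (p + 1)) D.E) i j)‖ ≤ C := by
    intro τ
    by_cases hτ : InfinitePlace.mk τ = InfinitePlace.mk D.τ₁
    · exact ⟨0, fun h ↦ (h hτ).elim⟩
    · obtain ⟨C, hC⟩ := D.exists_norm_embedding_apply_le τ hτ
      exact ⟨C, fun _ ↦ hC⟩
  choose C hC using hC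
  refine ⟨|R| + ∑ τ, |C τ|, fun γ hγ τ i j ↦ ?_⟩
  have hsum : 0 ≤ ∑ τ', |C τ'| := Finset.sum_nonneg fun _ _ ↦ abs_nonneg _
  by_cases hτ : InfinitePlace.mk τ = InfinitePlace.mk D.τ₁
  · rw [D.norm_embedding_eq_of_mk_eq hτ]
    exact ((hγ i j).trans (le_abs_self R)).trans (le_add_of_nonneg_right hsum)
  · calc ‖τ (((γ : GL (Fin (p + 1)) D.E) : Matrix (Fin (p + 1)) (Fin (p + 1)) D.E) i j)‖ ≤ C τ := hC τ hτ γ i j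
      _ ≤ |C τ| := le_abs_self _
      _ ≤ ∑ τ', |C τ'| := Finset.single_le_sum (f := fun τ' ↦ |C τ'|) (fun _ _ ↦ abs_nonneg _) (Finset.mem_univ τ)
      _ ≤ |R| + ∑ τ', |C τ'| := le_add_of_nonneg_left (abs_nonneg R)

/-- **Finiteness inside `Γ(𝔫)`**: only finitely many `γ ∈ Γ ∩ Γ(𝔫)` have all `τ₁`-entries of norm `≤ R` (integral elements of `E`
with all conjugates bounded form a finite set). [cite: Borel1969, §1] -/
theorem finite_setOf_mem_principal_of_τ₁ (n : ℕ) (R : ℝ) :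
    {γ : D.Γ | (γ : GL (Fin (p + 1)) D.E) ∈ principalCongruenceSubgroup (conjRingHom D.E) D.H n ∧
      ∀ i j, ‖D.τ₁ (((γ : GL (Fin (p + 1)) D.E) : Matrix (Fin (p + 1)) (Fin (p + 1)) D.E) i j)‖ ≤ R}.Finite := by
  obtain ⟨B, hB⟩ := D.exists_forall_norm_embedding_apply_le_of_τ₁ R
  set T : Set D.E := {x : D.E | IsIntegral ℤ x ∧ ∀ φ : D.E →+* ℂ, ‖φ x‖ ≤ B} with hT
  have hTfin : T.Finite := Embeddings.finite_of_norm_le D.E ℂ B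
  haveI : Finite T := hTfin.to_subtype
  let F : (Fin (p + 1) → Fin (p + 1) → T) → Matrix (Fin (p + 1)) (Fin (p + 1)) D.E := fun f ↦ Matrix.of fun i j ↦ (f i j : D.E)
  have hrange : (Set.range F).Finite := Set.finite_range F
  let M : D.Γ → Matrix (Fin (p + 1)) (Fin (p + 1)) D.E := fun γ ↦
    ((γ : GL (Fin (p + 1)) D.E) : Matrix (Fin (p + 1)) (Fin (p + 1)) D.E)
  have hMinj : Function.Injective M := fun γ γ' h ↦ Subtype.ext (Units.ext h)
  refine (hrange.preimage hMinj.injOn).subset fun γ hγ ↦ ?_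
  refine ⟨fun i j ↦ ⟨M γ i j, D.isIntegral_apply hγ.1 i j, fun φ ↦ hB γ hγ.2 φ i j⟩, ?_⟩
  ext i j
  rfl

/-- **Discreteness**: only finitely many `γ ∈ Γ` have all `τ₁`-entries of norm `≤ R` (reduce to the principal congruence subgroup,
of finite index: `γ = s·δ` with `s` a coset representative and `δ ∈ Γ(𝔫)` with bounded entries). [cite: Borel1969, §1] -/
theorem finite_setOf_norm_τ₁_apply_le (R : ℝ) :
    {γ : D.Γ | ∀ i j, ‖D.τ₁ (((γ : GL (Fin (p + 1)) D.E) : Matrix (Fin (p + 1)) (Fin (p + 1)) D.E) i j)‖ ≤ R}.Finite := by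
  obtain ⟨n, -, hle, hfi⟩ := D.isCongruenceSubgroup.2
  set N : Subgroup D.Γ := (principalCongruenceSubgroup (conjRingHom D.E) D.H n).subgroupOf D.Γ
  haveI : N.FiniteIndex := hfi
  let s : D.Γ ⧸ N → D.Γ := fun q ↦ q.out
  haveI : Fintype (D.Γ ⧸ N) := Fintype.ofFinite _
  -- a common bound for the `τ₁`-entries of the inverses of the coset representatives
  let nrm : D.Γ → Fin (p + 1) → Fin (p + 1) → ℝ := fun γ i j ↦
    ‖D.τ₁ (((γ : GL (Fin (p + 1)) D.E) : Matrix (Fin (p + 1)) (Fin (p + 1)) D.E) i j)‖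
  let C : ℝ := ∑ q : D.Γ ⧸ N, ∑ i, ∑ j, nrm (s q)⁻¹ i j
  have hCq : ∀ q i j, nrm (s q)⁻¹ i j ≤ C := fun q i j ↦ by
    calc nrm (s q)⁻¹ i j ≤ ∑ j', nrm (s q)⁻¹ i j' :=
          Finset.single_le_sum (f := fun j' ↦ nrm (s q)⁻¹ i j') (fun _ _ ↦ norm_nonneg _) (Finset.mem_univ j)
      _ ≤ ∑ i', ∑ j', nrm (s q)⁻¹ i' j' :=
          Finset.single_le_sum (f := fun i' ↦ ∑ j', nrm (s q)⁻¹ i' j') (fun _ _ ↦ Finset.sum_nonneg fun _ _ ↦ norm_nonneg _)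
            (Finset.mem_univ i)
      _ ≤ C := Finset.single_le_sum (f := fun q' ↦ ∑ i', ∑ j', nrm (s q')⁻¹ i' j')
            (fun _ _ ↦ Finset.sum_nonneg fun _ _ ↦ Finset.sum_nonneg fun _ _ ↦ norm_nonneg _) (Finset.mem_univ q)
  have hfin := (Set.finite_univ (α := D.Γ ⧸ N)).prod
    (D.finite_setOf_mem_principal_of_τ₁ n (Fintype.card (Fin (p + 1)) * (C * R)))
  refine (hfin.image fun qδ ↦ s qδ.1 * qδ.2).subset fun γ hγ ↦ ?_
  refine ⟨((γ : D.Γ ⧸ N), (s (γ : D.Γ ⧸ N))⁻¹ * γ), ⟨Set.mem_univ _, ?_, ?_⟩, by simp⟩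
  · have hmem : (s (γ : D.Γ ⧸ N))⁻¹ * γ ∈ N := by
      rw [← QuotientGroup.eq]
      exact QuotientGroup.out_eq' _
    exact Subgroup.mem_subgroupOf.1 hmem
  · intro i j
    have h := norm_mul_apply_le_card' (m := Fin (p + 1))
      (M := ((((s (γ : D.Γ ⧸ N))⁻¹ : D.Γ) : GL (Fin (p + 1)) D.E) : Matrix (Fin (p + 1)) (Fin (p + 1)) D.E).map D.τ₁)
      (N := (((γ : GL (Fin (p + 1)) D.E) : Matrix (Fin (p + 1)) (Fin (p + 1)) D.E).map D.τ₁))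
      (fun i j ↦ hCq (γ : D.Γ ⧸ N) i j) (fun i j ↦ hγ i j) i j
    rw [← Matrix.map_mul, Matrix.map_apply] at h
    change ‖D.τ₁ (((((s (γ : D.Γ ⧸ N))⁻¹ * γ : D.Γ) : GL (Fin (p + 1)) D.E) : Matrix (Fin (p + 1)) (Fin (p + 1)) D.E) i j)‖ ≤ _
    rw [Subgroup.coe_mul, Units.val_mul]
    exact h

/-! ### §5 Freeness: `Γ` fixes no negative line -/

/-- Powers act by powers: `γⁿ v = cⁿ v` if `γ v = c v`. [folklore] -/
private theorem act_pow_eq_smul {γ : GL (Fin (p + 1)) D.E} {v : Fin (p + 1) → ℂ} {c : ℂ} (h : D.act γ v = c • v) (n : ℕ) :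
    D.act (γ ^ n) v = c ^ n • v := by
  induction n with
  | zero =>
    simp only [act, pow_zero, Units.val_one, Matrix.map_one D.τ₁ (map_zero D.τ₁) (map_one D.τ₁), one_mulVec, one_smul]
  | succ n ih =>
    calc D.act (γ ^ (n + 1)) v = D.act (γ ^ n) (D.act γ v) := by
          simp only [act, pow_succ, Units.val_mul, Matrix.map_mul, mulVec_mulVec]
      _ = c ^ (n + 1) • v := by
          rw [h]
          simp only [act, mulVec_smul] at ih ⊢
          rw [ih, smul_smul, pow_succ, mul_comm]

/-- **Freeness**: if `γ ∈ Γ` fixes the negative LINE through `v₀` (`γ^{τ₁} v₀ = c v₀`) then `γ = 1` — all powers of `γ` have bounded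
`τ₁`-entries (two-point bound with `K = {v₀}`), so `γ` has finite order, and `Γ` is torsion free.
[cite: BergeronMillsonMoeglin2016Balls, Introduction §1.1] -/
theorem eq_one_of_act_eq_smul {γ : D.Γ} {v₀ : Fin (p + 1) → ℂ} (hv₀ : v₀ ∈ D.cone) {c : ℂ}
    (h : D.act γ v₀ = c • v₀) : γ = 1 := by
  have hc : c ≠ 0 := by
    rintro rfl
    have hmem := D.act_mem_cone γ.2 hv₀
    rw [h, zero_smul] at hmem
    have := mem_negCone_iff.1 hmem
    simp at this
  obtain ⟨R, hR⟩ := D.exists_norm_τ₁_apply_le_of_act_eq_smul isCompact_singleton (singleton_subset_iff.2 hv₀)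
    (singleton_nonempty v₀)
  have hpow : ∀ n : ℕ, γ ^ n ∈ {δ : D.Γ | ∀ i j,
      ‖D.τ₁ (((δ : GL (Fin (p + 1)) D.E) : Matrix (Fin (p + 1)) (Fin (p + 1)) D.E) i j)‖ ≤ R} := fun n ↦
    hR _ ⟨v₀, rfl, v₀, rfl, c ^ n, pow_ne_zero n hc, by rw [Subgroup.coe_pow]; exact D.act_pow_eq_smul h n⟩
  have hfin : IsOfFinOrder γ := by
    by_contra hnot
    have hinj : Function.Injective fun n : ℕ ↦ γ ^ n := injective_pow_iff_not_isOfFinOrder.2 hnot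
    refine (Set.infinite_range_of_injective hinj).mono ?_ (D.finite_setOf_norm_τ₁_apply_le R)
    rintro _ ⟨n, rfl⟩
    exact hpow n
  have hGL : IsOfFinOrder (γ : GL (Fin (p + 1)) D.E) := D.Γ.subtype.isOfFinOrder hfin
  exact OneMemClass.coe_eq_one.1 (D.torsionFree _ γ.2 hGL)

/-! ### §6 Separation and the main theorem -/

/-- Linear independence of two vectors is witnessed by a non-vanishing `2 × 2` minor, and a multiple of `w` has all its minors with
`w` equal to zero: if `u = c • w` then `u i * w j = u j * w i`. [folklore] -/
private theorem minor_eq_zero_of_eq_smul {u w : Fin (p + 1) → ℂ} {c : ℂ} (h : u = c • w) (i j : Fin (p + 1)) :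
    u i * w j - u j * w i = 0 := by
  rw [h, Pi.smul_apply, Pi.smul_apply, smul_eq_mul, smul_eq_mul]; ring

/-- Conversely, if all minors of `(u, w)` vanish and `w ≠ 0` then `u` is a multiple of `w`. [folklore] -/
private theorem exists_eq_smul_of_forall_minor_eq_zero {u w : Fin (p + 1) → ℂ} (hw : w ≠ 0)
    (h : ∀ i j, u i * w j - u j * w i = 0) : ∃ c : ℂ, u = c • w := by
  obtain ⟨j, hj⟩ := Function.ne_iff.1 hw
  refine ⟨u j / w j, funext fun i ↦ ?_⟩
  rw [Pi.smul_apply, smul_eq_mul, div_mul_eq_mul_div, eq_div_iff hj]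
  exact (sub_eq_zero.1 (h i j))

/-- **Separation**: if `γ ∈ Γ` does NOT fix the line `ℂ v₀` then, for `(v, w)` near `(v₀, v₀)`, `γ^{τ₁} v` is not a multiple of `w`.
[folklore] -/
private theorem exists_isOpen_forall_act_ne_smul {γ : GL (Fin (p + 1)) D.E} {v₀ : Fin (p + 1) → ℂ} (hv₀ : v₀ ≠ 0)
    (hγ : ∀ c : ℂ, D.act γ v₀ ≠ c • v₀) :
    ∃ V : Set (Fin (p + 1) → ℂ), IsOpen V ∧ v₀ ∈ V ∧ ∀ v ∈ V, ∀ w ∈ V, ∀ c : ℂ, D.act γ v ≠ c • w := by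
  -- a non-vanishing minor of `(γ v₀, v₀)`
  obtain ⟨i, j, hij⟩ : ∃ i j, D.act γ v₀ i * v₀ j - D.act γ v₀ j * v₀ i ≠ 0 := by
    by_contra hall
    push Not at hall
    obtain ⟨c, hc⟩ := exists_eq_smul_of_forall_minor_eq_zero hv₀ hall
    exact hγ c hc
  -- the minor is a continuous function of `(v, w)`
  have hact : Continuous fun v : Fin (p + 1) → ℂ ↦ D.act γ v := continuous_const.matrix_mulVec continuous_id
  have hcont : Continuous fun z : (Fin (p + 1) → ℂ) × (Fin (p + 1) → ℂ) ↦
      D.act γ z.1 i * z.2 j - D.act γ z.1 j * z.2 i :=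
    (((continuous_apply i).comp (hact.comp continuous_fst)).mul ((continuous_apply j).comp continuous_snd)).sub
      (((continuous_apply j).comp (hact.comp continuous_fst)).mul ((continuous_apply i).comp continuous_snd))
  have hopen : IsOpen {z : (Fin (p + 1) → ℂ) × (Fin (p + 1) → ℂ) | D.act γ z.1 i * z.2 j - D.act γ z.1 j * z.2 i ≠ 0} :=
    isOpen_ne_fun hcont continuous_const
  have hmem : (v₀, v₀) ∈ {z : (Fin (p + 1) → ℂ) × (Fin (p + 1) → ℂ) | D.act γ z.1 i * z.2 j - D.act γ z.1 j * z.2 i ≠ 0} := hij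
  obtain ⟨V₁, V₂, hV₁, hV₂, h₁, h₂, hsub⟩ := isOpen_prod_iff.1 hopen v₀ v₀ hmem
  refine ⟨V₁ ∩ V₂, hV₁.inter hV₂, ⟨h₁, h₂⟩, fun v hv w hw c hc ↦ ?_⟩
  have hz : (v, w) ∈ {z : (Fin (p + 1) → ℂ) × (Fin (p + 1) → ℂ) | D.act γ z.1 i * z.2 j - D.act γ z.1 j * z.2 i ≠ 0} :=
    hsub (mk_mem_prod hv.1 hw.2)
  exact hz (minor_eq_zero_of_eq_smul hc i j)

/-- **MAIN THEOREM — the uniformisation is locally injective modulo `ℂˣ` on the cone** (every rank `p`): every negative vector `v₀`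
has an open neighbourhood `U` such that cone vectors `v, w ∈ U` with `unif v = unif w` are proportional.  (`K` a compact cone
neighbourhood of `v₀`; the finitely many `γ ∈ Γ` with `τ₁`-entries below the two-point bound of `K` (§3–§4) other than `1` do not fix
the line `ℂ v₀` (§5) and are separated near `(v₀, v₀)` (§6); on the resulting `U`, `unif v = unif w` means `γ^{τ₁} v = c w` with `γ` in
that finite set, hence `γ = 1`.)  This is the hypothesis `hinj` of ★ `exists_mdifferentiableAt_section`.
[cite: Borel1969, Prop. 7.13] [cite: BergeronMillsonMoeglin2016Balls, Introduction §1.1] -/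
theorem exists_isOpen_unif_eq_unif_imp_smul {v₀ : Fin (p + 1) → ℂ} (hv₀ : v₀ ∈ D.cone) :
    ∃ U : Set (Fin (p + 1) → ℂ), IsOpen U ∧ v₀ ∈ U ∧
      ∀ v ∈ U, ∀ w ∈ U, v ∈ D.cone → w ∈ D.cone → D.unif v = D.unif w → ∃ c : ℂ, v = c • w := by
  classical
  -- a compact cone neighbourhood `K = closedBall v₀ r`
  obtain ⟨r, hr, hball⟩ := Metric.isOpen_iff.1 (isOpen_negCone D.Hℂ) v₀ hv₀
  set K : Set (Fin (p + 1) → ℂ) := Metric.closedBall v₀ (r / 2) with hK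
  have hKc : K ⊆ D.cone := (Metric.closedBall_subset_ball (half_lt_self hr)).trans hball
  have hKcpt : IsCompact K := isCompact_closedBall v₀ (r / 2)
  have hv₀K : v₀ ∈ K := Metric.mem_closedBall_self (half_pos hr).le
  obtain ⟨R, hR⟩ := D.exists_norm_τ₁_apply_le_of_act_eq_smul hKcpt hKc ⟨v₀, hv₀K⟩
  set F : Set D.Γ := {γ : D.Γ | ∀ i j,
    ‖D.τ₁ (((γ : GL (Fin (p + 1)) D.E) : Matrix (Fin (p + 1)) (Fin (p + 1)) D.E) i j)‖ ≤ R} with hF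
  have hFfin : F.Finite := D.finite_setOf_norm_τ₁_apply_le R
  have hv₀ne : v₀ ≠ 0 := fun h ↦ by
    have := mem_negCone_iff.1 hv₀; rw [h] at this; simp at this
  -- separating neighbourhoods for `γ ∈ F`, `γ ≠ 1`
  have hsep : ∀ γ : D.Γ, ∃ V : Set (Fin (p + 1) → ℂ), IsOpen V ∧ v₀ ∈ V ∧
      (γ ≠ 1 → ∀ v ∈ V, ∀ w ∈ V, ∀ c : ℂ, D.act γ v ≠ c • w) := by
    intro γ
    by_cases hγ : γ = 1
    · exact ⟨univ, isOpen_univ, mem_univ _, fun h ↦ (h hγ).elim⟩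
    · have hline : ∀ c : ℂ, D.act γ v₀ ≠ c • v₀ := fun c hc ↦ hγ (D.eq_one_of_act_eq_smul hv₀ hc)
      obtain ⟨V, hVo, hVm, hV⟩ := D.exists_isOpen_forall_act_ne_smul hv₀ne hline
      exact ⟨V, hVo, hVm, fun _ ↦ hV⟩
  choose V hVo hVm hV using hsep
  refine ⟨Metric.ball v₀ (r / 2) ∩ ⋂ γ ∈ F, V γ,
    Metric.isOpen_ball.inter (hFfin.isOpen_biInter fun γ _ ↦ hVo γ),
    ⟨Metric.mem_ball_self (half_pos hr), mem_iInter₂.2 fun γ _ ↦ hVm γ⟩, fun v hv w hw hvc hwc heq ↦ ?_⟩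
  obtain ⟨γ, hγΓ, c, hc, hγv⟩ := (D.unif_eq_unif_iff v hvc w hwc).1 heq
  have hvK : v ∈ K := Metric.ball_subset_closedBall hv.1
  have hwK : w ∈ K := Metric.ball_subset_closedBall hw.1
  have hγF : (⟨γ, hγΓ⟩ : D.Γ) ∈ F := hR ⟨γ, hγΓ⟩ ⟨v, hvK, w, hwK, c, hc, hγv⟩
  by_cases hγ1 : (⟨γ, hγΓ⟩ : D.Γ) = 1
  · have hγ1' : γ = 1 := congrArg Subtype.val hγ1
    refine ⟨c, ?_⟩
    rw [hγ1'] at hγv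
    simpa [act, Matrix.map_one D.τ₁ (map_zero D.τ₁) (map_one D.τ₁)] using hγv
  · exact (hV ⟨γ, hγΓ⟩ hγ1 v (mem_iInter₂.1 hv.2 _ hγF) w (mem_iInter₂.1 hw.2 _ hγF) c hγv).elim

/-- **Corollary — holomorphic local sections of the uniformisation exist through every negative vector, in every rank** (★
`exists_mdifferentiableAt_section` with its hypothesis `hinj` discharged by `exists_isOpen_unif_eq_unif_imp_smul`).
[cite: FritzscheGrauert2002, Ch. I §8 Thm. 8.5 and Cor. 8.6] [cite: BergeronMillsonMoeglin2016Balls, Introduction §1.1] -/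
theorem exists_mdifferentiableAt_section' (A : HodgeModel p X) {v₀ : Fin (p + 1) → ℂ} (hv₀ : v₀ ∈ D.cone) :
    ∃ (W : Set A.carrier) (σ : A.carrier → (Fin (p + 1) → ℂ)), IsOpen W ∧
      A.isAnalytification.homeomorph.symm (D.unif v₀) ∈ W ∧
      σ (A.isAnalytification.homeomorph.symm (D.unif v₀)) = v₀ ∧
      (∀ y ∈ W, σ y ∈ D.cone ∧ D.unif (σ y) = A.toComplexPoints y) ∧
      ∀ y ∈ W, MDifferentiableAt 𝓘(ℂ, A.model) 𝓘(ℂ, Fin (p + 1) → ℂ) σ y :=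
  D.exists_mdifferentiableAt_section A hv₀ (D.exists_isOpen_unif_eq_unif_imp_smul hv₀)

end UnitaryBallUniformisationDatum

end Literature.AlgebraicGeometry.ShimuraVarieties

end
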